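import Summits.ValiantsHypothesis.ValiantsHypothesis.Theorems.KPlusLogSqLawTropicalRecombinationReach

/-!
# Route «KPlusLogSqLaw», crux `WeakLifting` (stmt-ValiantsHypothesis-19561), docket D2 — the MEAN (covariance) form of the RECOMBINATION
# REACH LAW: order-free, gauge-invariant, one inequality per supplier; sharpens `RecombinationReach.reach_lt`

HONEST FRAMING.  Helper file (cell `pub-symmetroid`, seat val-sym-lift-p3 g26, 2026-08-29) `--supports` the crux
`Summit.ValiantsHypothesis.ValiantsHypothesis.Theses.KPlusLogSqLaw.WeakLifting` (ledger item `stmt-ValiantsHypothesis-19561`, route `KPlusLogSqLaw`;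
lineage docket D2 = the `K = 4` exponent fork of the aside `Lifting`, whose live question is the number `Z` of «zero-fresh» steps — columnwise
RECOMBINATIONS of earlier terms — along a dominant chain, `n + m ≤ #used incidences + Z`, `…TropicalFreshIncidences`).  STRUCTURE law for
dominant terms of an ARBITRARY dominance design (any format `(m, K)`, any exponents and valuations, no sign hypothesis, NO ORDER HYPOTHESIS on the
slopes); it bounds no tropical row and asserts nothing about `WeakLifting`, `TropicalB`, `Lifting`, `KPlusLogSqLaw`, `MatrixDescartes`
(stmt-ValiantsHypothesis-18050) or VP ≠ VNP.  No `def`.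

THE LAW (`reach_lt_mean`).  Let `t₀, …, t_k` (`k ≥ 1`) be dominant (unique optima) at integer slopes `θ₀, …, θ_k` — in ANY order, repetitions
of slopes allowed — and let `M` choose in every column the entry-class of one of the `t`'s, with bijective rows (a columnwise recombination;
`slope d p = Σ_i d (p.2 i)`), `M ≠ t_k` (the DISTINGUISHED supplier, listed last).  Write `Θ = Σ_{j<k} θ_j`.  Then
  `(k·θ_k − Θ) · (slope M − slope t_k) < Σ_{j<k} (k·θ_j − Θ) · slope t_j`.
Dividing by `k`: `(θ_k − θ̄)·(slope M − slope t_k) < Σ_{j<k} (θ_j − θ̄)·slope t_j = Σ_{j<k}(θ_j − θ̄)(slope t_j − c)` for every constant `c`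
(`θ̄` = mean of the other suppliers' slopes; `Σ_{j<k}(θ_j − θ̄) = 0`), i.e. `k`-times the covariance of slope-parameter and term-slope over the
other suppliers: the law is invariant under a common shift of all exponents (GAUGE-INVARIANT), which the tree's `reach_lt`
(`(θ_k − θ₀)·slope M < Σ_r (θ_r − θ₀)·slope t_r`, p725800) is not.  READINGS.  (i) `θ_k` the LARGEST slope: the reach of a recombination
ABOVE its last supplier is `< Cov/(θ_k − θ̄)`; (ii) `θ_k` the SMALLEST: `(θ̄ − θ_k)·(slope t_k − slope M) < −Σ_{j<k}(θ_j − θ̄)·slope t_j`, the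
reach BELOW the first supplier; (iii) a middle supplier gives a mixed constraint — one inequality per supplier that `M` differs from.  TWO
SUPPLIERS (`k = 1`, `reach_two`): `(θ₁ − θ₀)·(slope M − slope t₁) < 0` — a recombination of two dominant terms different from both lies
STRICTLY BETWEEN them in slope (the tree's `not_hybrid_of_two_earlier` / `…_later` in one order-free line).  THREE SUPPLIERS (`k = 2`,
`reach_lt_mean_three`): `(2θ_c − θ_a − θ_b)·(slope M − slope t_c) < (θ_b − θ_a)·(slope t_b − slope t_a)`; for `θ_a < θ_b < θ_c` a term
recombined from three EARLIER chain terms overshoots the last by less than `(θ_b − θ_a)/((θ_c − θ_a) + (θ_c − θ_b))` times the slope gap of the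
first two (the tree's form has `slope t_b` in place of `slope t_b − slope t_a` and `θ_c − θ_a` in place of `2θ_c − θ_a − θ_b`).
PROOF (direct; no re-indexing of the exchange lemma): König (`pageRigid_konig`, p494347) splits the leftover `t₀ ⊎ ⋯ ⊎ t_k − M` into `k` terms
`u₁..u_k`; each `t_j`, `j < k`, weakly beats each `u_{j'}` at `θ_j` (`k²` inequalities), `t_k` strictly beats `M` at `θ_k`, and the columnwise
multiset identity makes the valuations AND the slopes of `M, u₁, …, u_k` sum to those of `t₀, …, t_k`; adding everything, the valuations cancel.
(Equivalently: the average of the exchange lemma `sum_mul_slope_lt_of_redecomp` over the `k` cyclic slot assignments of the `u`'s; `reach_lt`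
is one slot assignment followed by `θ_j ≥ θ₀`, `slope ≥ 0`.)  Chain form `reach_lt_mean_chain` (positions `a 0, …, a k` supplying position
`x ≠ a k` of an injective chain).  LP REMARK (paper, this seat, not formalised): for three suppliers, eliminating the unknown valuations of the two leftover terms from ALL
dominance inequalities among `t_a, t_b, t_c, M` and the leftovers yields the three instances of this law (one per distinguished supplier) and,
as far as we computed, nothing sharper in `(θ, slope)` alone.
[folklore LP-duality / exchange reasoning for the assignment polytope; König packaging = the tree's p494347; statements are the cell's]
-/

set_option linter.dupNamespace false
set_option autoImplicit false

namespace Summit.ValiantsHypothesis.ValiantsHypothesis.Theorems.KPlusLogSqLaw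

open Summit.ValiantsHypothesis.ValiantsHypothesis.Theorems.MatrixDescartes.Negative
open Summit.ValiantsHypothesis.ValiantsHypothesis.Theorems.LacunarySymmetroidMatrixDescartes.TropicalCensus
open scoped BigOperators
open Finset

namespace RecombinationReachMean

variable {m K : ℕ}

/-- **MEAN (COVARIANCE) FORM OF THE RECOMBINATION REACH LAW.**  `t₀..t_k` dominant at integer slopes `θ₀..θ_k` (no order hypothesis), `k ≥ 1`;
`M` a columnwise recombination of them with bijective rows, different from the distinguished supplier `t_k`.  Then, with `Θ = Σ_{j<k} θ_j`,
`(k·θ_k − Θ)·(slope M − slope t_k) < Σ_{j<k} (k·θ_j − Θ)·slope t_j`. -/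
theorem reach_lt_mean {k : ℕ} (hk : 1 ≤ k) (d : Fin K → ℕ) (v ε : Fin m → Fin m → Fin K → ℤ)
    (θ : Fin (k + 1) → ℤ) (t : Fin (k + 1) → Equiv.Perm (Fin m) × (Fin m → Fin K))
    (hdom : ∀ r, IsDominant d v ε (θ r) (t r))
    (sel : Fin m → Fin (k + 1)) (hbij : Function.Bijective fun i => (t (sel i)).1 i)
    (hM : ((Equiv.ofBijective _ hbij, fun i => (t (sel i)).2 i) : Equiv.Perm (Fin m) × (Fin m → Fin K)) ≠ t (Fin.last k)) :
    ((k : ℤ) * θ (Fin.last k) - ∑ j : Fin k, θ j.castSucc) *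
        (slope d (Equiv.ofBijective _ hbij, fun i => (t (sel i)).2 i) - slope d (t (Fin.last k)))
      < ∑ j : Fin k, ((k : ℤ) * θ j.castSucc - ∑ j' : Fin k, θ j'.castSucc) * slope d (t j.castSucc) := by
  classical
  -- the layers and their regularity (verbatim as in `RecombinationReach.reach_lt`)
  let e : Fin (k + 1) → Fin m → Fin m × Fin K := fun j i => ((t j).1 i, (t j).2 i)
  have hreg : ∀ a : Fin m, ((univ : Finset (Fin (k + 1) × Fin m)).filter fun p => (e p.1 p.2).1 = a).card = k + 1 := by
    intro a
    have h : ((univ : Finset (Fin (k + 1) × Fin m)).filter fun p => (e p.1 p.2).1 = a)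
        = (univ : Finset (Fin (k + 1))).image (fun j => (j, ((t j).1).symm a)) := by
      ext p
      simp only [mem_filter, mem_univ, true_and, mem_image, e]
      constructor
      · intro hp
        refine ⟨p.1, ?_⟩
        have : ((t p.1).1).symm a = p.2 := by rw [← hp]; simp
        rw [this]
      · rintro ⟨j, rfl⟩
        simp
    rw [h, card_image_of_injective _ (fun j j' hjj' => (Prod.mk.inj hjj').1)]
    simp
  have hbij' : Function.Bijective fun i => (e (sel i) i).1 := hbij
  let e' : Fin k → Fin m → Fin m × Fin K := fun j i => e ((sel i).succAbove j) i
  have hreg' := pageRigid_leftover_regular e hreg sel hbij'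
  obtain ⟨u', hu'⟩ := pageRigid_konig k e' hreg'
  set M : Equiv.Perm (Fin m) × (Fin m → Fin K) := (Equiv.ofBijective _ hbij, fun i => (t (sel i)).2 i) with hMdef
  let U : Fin (k + 1) → Equiv.Perm (Fin m) × (Fin m → Fin K) := Fin.cons M u'
  have hcol : ∀ i : Fin m, (univ : Finset (Fin (k + 1))).val.map (fun r => ((U r).1 i, (U r).2 i)) =
      (univ : Finset (Fin (k + 1))).val.map (fun r => ((t r).1 i, (t r).2 i)) := by
    intro i
    have hL : (univ : Finset (Fin (k + 1))).val.map (fun r => ((U r).1 i, (U r).2 i))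
        = e (sel i) i ::ₘ (univ : Finset (Fin k)).val.map (fun j => e' j i) := by
      rw [Fin.univ_succ, cons_val, Multiset.map_cons, map_val, Multiset.map_map]
      congr 1
      rw [← hu' i]
      rfl
    have hR : (univ : Finset (Fin (k + 1))).val.map (fun r => ((t r).1 i, (t r).2 i))
        = e (sel i) i ::ₘ (univ : Finset (Fin k)).val.map (fun j => e' j i) := by
      rw [Fin.univ_succAbove k (sel i), cons_val, Multiset.map_cons, map_val, Multiset.map_map]
      rfl
    rw [hL, hR]
  -- every member of `U` is present
  have hpres : ∀ r, termSign ε (U r) ≠ 0 := fun r => termSign_ne_zero_of_redecomp d v ε θ t U hdom hcol r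
  -- valuation totals
  let V : Equiv.Perm (Fin m) × (Fin m → Fin K) → ℤ := fun p => ∑ i, v (p.1 i) i (p.2 i)
  have hVsum : ∑ r, V (U r) = ∑ r, V (t r) := by
    show ∑ r, ∑ i, v ((U r).1 i) i ((U r).2 i) = ∑ r, ∑ i, v ((t r).1 i) i ((t r).2 i)
    rw [sum_comm, sum_comm (f := fun r i => v ((t r).1 i) i ((t r).2 i))]
    exact sum_congr rfl fun i _ => sum_col_eq_of_redecomp t U hcol (fun i a l => v a i l) i
  have hSsum : ∑ r, slope d (U r) = ∑ r, slope d (t r) := by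
    unfold LacunarySymmetroidMatrixDescartes.TropicalCensus.slope
    exact pageRigid_sum_colfun_eq_of_redecomp t U hcol (fun _ l => (d l : ℤ))
  -- split off the head: `U 0 = M`, `U (succ j') = u' j'`
  have hU0 : U 0 = M := rfl
  have hUs : ∀ j' : Fin k, U j'.succ = u' j' := fun j' => rfl
  have hVsplit : V M + ∑ j' : Fin k, V (u' j') = V (t (Fin.last k)) + ∑ j : Fin k, V (t j.castSucc) := by
    have h1 : ∑ r, V (U r) = V M + ∑ j' : Fin k, V (u' j') := by rw [Fin.sum_univ_succ]; rfl
    have h2 : ∑ r, V (t r) = (∑ j : Fin k, V (t j.castSucc)) + V (t (Fin.last k)) := by rw [Fin.sum_univ_castSucc]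
    linarith [hVsum]
  have hSsplit : slope d M + ∑ j' : Fin k, slope d (u' j') = slope d (t (Fin.last k)) + ∑ j : Fin k, slope d (t j.castSucc) := by
    have h1 : ∑ r, slope d (U r) = slope d M + ∑ j' : Fin k, slope d (u' j') := by rw [Fin.sum_univ_succ]; rfl
    have h2 : ∑ r, slope d (t r) = (∑ j : Fin k, slope d (t j.castSucc)) + slope d (t (Fin.last k)) := by
      rw [Fin.sum_univ_castSucc]
    linarith [hSsum]
  -- (a) the `k²` weak dominances: `t_j` (j < k) beats `u'_{j'}` at `θ_j`
  have hweak : ∀ j j' : Fin k, θ j.castSucc * slope d (u' j') - V (u' j') ≤ θ j.castSucc * slope d (t j.castSucc) - V (t j.castSucc) := by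
    intro j j'
    have hle : tropWeight d v (θ j.castSucc) (u' j') ≤ tropWeight d v (θ j.castSucc) (t j.castSucc) := by
      by_cases h : u' j' = t j.castSucc
      · rw [h]
      · exact le_of_lt ((hdom j.castSucc).2 (u' j') h (by rw [← hUs]; exact hpres _))
    rwa [tropWeight_eq_slope_sub, tropWeight_eq_slope_sub] at hle
  -- summed over `j'` for fixed `j`, then over `j`
  have hrow : ∀ j : Fin k, θ j.castSucc * (∑ j' : Fin k, slope d (u' j')) - ∑ j' : Fin k, V (u' j')
      ≤ (k : ℤ) * (θ j.castSucc * slope d (t j.castSucc) - V (t j.castSucc)) := by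
    intro j
    have h := sum_le_sum fun j' (_ : j' ∈ (univ : Finset (Fin k))) => hweak j j'
    rw [sum_const, card_univ, Fintype.card_fin, nsmul_eq_mul, sum_sub_distrib, ← mul_sum] at h
    exact h
  have hall : (∑ j : Fin k, θ j.castSucc) * (∑ j' : Fin k, slope d (u' j')) - (k : ℤ) * ∑ j' : Fin k, V (u' j')
      ≤ (k : ℤ) * ∑ j : Fin k, (θ j.castSucc * slope d (t j.castSucc) - V (t j.castSucc)) := by
    have h := sum_le_sum fun j (_ : j ∈ (univ : Finset (Fin k))) => hrow j
    rw [sum_sub_distrib, sum_const, card_univ, Fintype.card_fin, nsmul_eq_mul, ← sum_mul, ← mul_sum] at h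
    exact h
  -- (b) the strict dominance: `t_k` beats `M` at `θ_k`
  have hstrict : θ (Fin.last k) * slope d M - V M < θ (Fin.last k) * slope d (t (Fin.last k)) - V (t (Fin.last k)) := by
    have hlt : tropWeight d v (θ (Fin.last k)) M < tropWeight d v (θ (Fin.last k)) (t (Fin.last k)) :=
      (hdom (Fin.last k)).2 M hM (by rw [← hU0]; exact hpres 0)
    rwa [tropWeight_eq_slope_sub, tropWeight_eq_slope_sub] at hlt
  -- (c) combine: the valuations cancel
  have hk' : (1 : ℤ) ≤ (k : ℤ) := by exact_mod_cast hk
  set Θ := ∑ j : Fin k, θ j.castSucc with hΘ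
  set SU := ∑ j' : Fin k, slope d (u' j') with hSU
  set VU := ∑ j' : Fin k, V (u' j') with hVU
  set ST := ∑ j : Fin k, slope d (t j.castSucc) with hST
  have hsplitV : ∑ j : Fin k, (θ j.castSucc * slope d (t j.castSucc) - V (t j.castSucc))
      = (∑ j : Fin k, θ j.castSucc * slope d (t j.castSucc)) - ∑ j : Fin k, V (t j.castSucc) := sum_sub_distrib _ _
  rw [hsplitV] at hall
  -- from (b) times k and (a):  Θ·SU + k·θ_k·(slope M − slope t_k) < k·Σ θ_j slope t_j
  have hkey : Θ * SU + (k : ℤ) * (θ (Fin.last k) * (slope d M - slope d (t (Fin.last k))))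
      < (k : ℤ) * ∑ j : Fin k, θ j.castSucc * slope d (t j.castSucc) := by
    have hb : (k : ℤ) * (θ (Fin.last k) * slope d M - V M) < (k : ℤ) * (θ (Fin.last k) * slope d (t (Fin.last k)) - V (t (Fin.last k))) :=
      mul_lt_mul_of_pos_left hstrict (by linarith)
    nlinarith [hall, hb, hVsplit]
  -- substitute SU = slope t_k + ST − slope M
  have hSU' : SU = slope d (t (Fin.last k)) + ST - slope d M := by linarith [hSsplit]
  rw [hSU'] at hkey
  -- expand the goal's right-hand side
  have hgoal : ∑ j : Fin k, ((k : ℤ) * θ j.castSucc - Θ) * slope d (t j.castSucc)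
      = (k : ℤ) * (∑ j : Fin k, θ j.castSucc * slope d (t j.castSucc)) - Θ * ST := by
    rw [hST, mul_sum, mul_sum, ← sum_sub_distrib]
    exact sum_congr rfl fun j _ => by ring
  rw [hgoal]
  nlinarith [hkey]

/-- **Three suppliers** (`k = 2`): for `t_a, t_b, t_c` dominant at `θ_a, θ_b, θ_c` (any order) and a columnwise recombination `M ≠ t_c` of them,
`(2θ_c − θ_a − θ_b)·(slope M − slope t_c) < (θ_b − θ_a)·(slope t_b − slope t_a)`; read with `θ_a < θ_b < θ_c` it throttles the reach of a
recombination of three EARLIER chain terms beyond the last one by the slope gap of the first two. -/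
theorem reach_lt_mean_three (d : Fin K → ℕ) (v ε : Fin m → Fin m → Fin K → ℤ)
    (θ : Fin 3 → ℤ) (t : Fin 3 → Equiv.Perm (Fin m) × (Fin m → Fin K))
    (hdom : ∀ r, IsDominant d v ε (θ r) (t r))
    (sel : Fin m → Fin 3) (hbij : Function.Bijective fun i => (t (sel i)).1 i)
    (hM : ((Equiv.ofBijective _ hbij, fun i => (t (sel i)).2 i) : Equiv.Perm (Fin m) × (Fin m → Fin K)) ≠ t 2) :
    (2 * θ 2 - θ 0 - θ 1) * (slope d (Equiv.ofBijective _ hbij, fun i => (t (sel i)).2 i) - slope d (t 2))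
      < (θ 1 - θ 0) * (slope d (t 1) - slope d (t 0)) := by
  have h := reach_lt_mean (k := 2) (by norm_num) d v ε θ t hdom sel hbij hM
  simp only [Fin.sum_univ_two, Fin.castSucc_zero, Fin.castSucc_one, Nat.cast_ofNat] at h
  have h2 : (Fin.last 2 : Fin 3) = 2 := rfl
  rw [h2] at h
  nlinarith [h]

/-- **Two suppliers** (`k = 1`): a columnwise recombination `M` of two dominant terms `t₀` (at `θ₀`) and `t₁` (at `θ₁`) with `M ≠ t₁`
satisfies `(θ₁ − θ₀)·(slope M − slope t₁) < 0`: if also `M ≠ t₀`, its slope lies strictly between the suppliers' slopes (in particular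
`θ₀ ≠ θ₁` and `slope t₀ ≠ slope t₁`). -/
theorem reach_two (d : Fin K → ℕ) (v ε : Fin m → Fin m → Fin K → ℤ)
    (θ : Fin 2 → ℤ) (t : Fin 2 → Equiv.Perm (Fin m) × (Fin m → Fin K))
    (hdom : ∀ r, IsDominant d v ε (θ r) (t r))
    (sel : Fin m → Fin 2) (hbij : Function.Bijective fun i => (t (sel i)).1 i)
    (hM : ((Equiv.ofBijective _ hbij, fun i => (t (sel i)).2 i) : Equiv.Perm (Fin m) × (Fin m → Fin K)) ≠ t 1) :
    (θ 1 - θ 0) * (slope d (Equiv.ofBijective _ hbij, fun i => (t (sel i)).2 i) - slope d (t 1)) < 0 := by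
  have h := reach_lt_mean (k := 1) le_rfl d v ε θ t hdom sel hbij hM
  simp only [Fin.sum_univ_one, Fin.castSucc_zero, Nat.cast_one, one_mul] at h
  have h1 : (Fin.last 1 : Fin 2) = 1 := rfl
  rw [h1] at h
  linarith [h]

/-- **Chain form.**  Along an injective family of terms `p r` dominant at slopes `θ r`, if the term at position `x` is a columnwise recombination of
the terms at positions `a 0, …, a k` (`k ≥ 1`, `a k ≠ x`; no order hypothesis), then with `Θ = Σ_{j<k} θ (a j)`:
`(k·θ (a k) − Θ)·(slope (p x) − slope (p (a k))) < Σ_{j<k} (k·θ (a j) − Θ)·slope (p (a j))`. -/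
theorem reach_lt_mean_chain {n k : ℕ} (hk : 1 ≤ k) (d : Fin K → ℕ) (v ε : Fin m → Fin m → Fin K → ℤ)
    (θ : Fin (n + 1) → ℤ) (p : Fin (n + 1) → Equiv.Perm (Fin m) × (Fin m → Fin K))
    (hdom : ∀ r, IsDominant d v ε (θ r) (p r)) (hinj : Function.Injective p)
    (a : Fin (k + 1) → Fin (n + 1)) (x : Fin (n + 1)) (hax : a (Fin.last k) ≠ x)
    (hrec : ∀ i, ∃ r, ((p (a r)).1 i, (p (a r)).2 i) = ((p x).1 i, (p x).2 i)) :
    ((k : ℤ) * θ (a (Fin.last k)) - ∑ j : Fin k, θ (a j.castSucc)) * (slope d (p x) - slope d (p (a (Fin.last k))))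
      < ∑ j : Fin k, ((k : ℤ) * θ (a j.castSucc) - ∑ j' : Fin k, θ (a j'.castSucc)) * slope d (p (a j.castSucc)) := by
  classical
  choose sel hsel using hrec
  have hsel1 : ∀ i, (p (a (sel i))).1 i = (p x).1 i := fun i => (Prod.mk.inj (hsel i)).1
  have hsel2 : ∀ i, (p (a (sel i))).2 i = (p x).2 i := fun i => (Prod.mk.inj (hsel i)).2
  have hbij : Function.Bijective fun i => ((p ∘ a) (sel i)).1 i := by
    have : (fun i => ((p ∘ a) (sel i)).1 i) = (p x).1 := funext hsel1
    rw [this]; exact (p x).1.bijective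
  have hMx : ((Equiv.ofBijective _ hbij, fun i => ((p ∘ a) (sel i)).2 i) : Equiv.Perm (Fin m) × (Fin m → Fin K)) = p x := by
    refine Prod.ext ?_ ?_
    · ext i; exact congrArg Fin.val (hsel1 i)
    · funext i; exact hsel2 i
  have hM : ((Equiv.ofBijective _ hbij, fun i => ((p ∘ a) (sel i)).2 i) : Equiv.Perm (Fin m) × (Fin m → Fin K))
      ≠ (p ∘ a) (Fin.last k) := by
    intro h
    rw [hMx] at h
    exact hax (hinj h).symm
  have h := reach_lt_mean hk d v ε (θ ∘ a) (p ∘ a) (fun r => hdom (a r)) sel hbij hM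
  rw [hMx] at h
  simpa using h

end RecombinationReachMean

end Summit.ValiantsHypothesis.ValiantsHypothesis.Theorems.KPlusLogSqLaw
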